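import Mathlib.Tactic.Group
import Mathlib.Data.Complex.Basic
import Summits.MatrixMultiplication.MatrixMultiplication.Theses.LevelGradedCohnUmans
import Literature.Combinatorics.Additive.TripleProductProperty

/-!
# `SepImpliesTPP` — `J`-separation implies the triple product property

Route `MatrixMultiplication/LevelGradedCohnUmans`, item `stmt-MatrixMultiplication-7618` (support):
if for every target `(x₀, z₀) ∈ X × Z` some test function `f : G → ℂ` satisfies
`f (x⁻¹ y y'⁻¹ z) = [x = x₀ ∧ y = y' ∧ z = z₀]` on all of `X × Y × Y × Z`, then `(X, Y, Z)` has the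
triple product property of Cohn–Umans (tree: `Literature.Combinatorics.Additive.TripleProductProperty`,
the `s s'⁻¹ · t t'⁻¹ · u u'⁻¹ = 1` form).  The test space `J` plays no role.

Proof.  Let `s, s' ∈ X`, `t, t' ∈ Y`, `u, u' ∈ Z` with `s s'⁻¹ (t t'⁻¹) (u u'⁻¹) = 1` and let `f`
separate the target `(s, u')`.  The target quadruple `(s, t, t, u')` gives `f (s⁻¹ t t⁻¹ u') = 1`,
while the relation rewrites the word of the quadruple `(s', t, t', u)` to the same group element,
`s'⁻¹ t t'⁻¹ u = s⁻¹ t t⁻¹ u'`; so `(s', t, t', u)` cannot lie on the `0`-branch, i.e.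
`s' = s`, `t = t'`, `u = u'`.
-/

-- single-conjunct summit: the mandated namespace `Summit.MatrixMultiplication.MatrixMultiplication.…`
-- repeats `MatrixMultiplication` (summit = sub-problem), which `linter.dupNamespace` would flag.
set_option linter.dupNamespace false

namespace Summit.MatrixMultiplication.MatrixMultiplication.Theorems

/-- **`J`-separation implies the triple product property** (settles
`stmt-MatrixMultiplication-7618`, exact route signature
`Summit.MatrixMultiplication.MatrixMultiplication.Theses.LevelGradedCohnUmans.SepImpliesTPP`):
if every target `(x₀, z₀) ∈ X × Z` is separated by some `f : G → ℂ` with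
`f (x⁻¹ y y'⁻¹ z) = [x = x₀ ∧ y = y' ∧ z = z₀]` on `X × Y × Y × Z`, then `X, Y, Z` satisfy
`TripleProductProperty` (Cohn–Umans 2003, Def. 2.1).  Evaluate the separator of the target `(s, u')`
at the quadruples `(s, t, t, u')` (value `1`) and `(s', t, t', u)` (same argument by the relation
`s s'⁻¹ t t'⁻¹ u u'⁻¹ = 1`), forcing the latter to be a target quadruple. [folklore] -/
theorem SepImpliesTPP_proof :
    Summit.MatrixMultiplication.MatrixMultiplication.Theses.LevelGradedCohnUmans.SepImpliesTPP := by
  unfold Summit.MatrixMultiplication.MatrixMultiplication.Theses.LevelGradedCohnUmans.SepImpliesTPP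
  intro G _ J X Y Z hsep s hs s' hs' t ht t' ht' u hu u' hu' hprod
  obtain ⟨f, -, hf⟩ := hsep s hs u' hu'
  -- the target quadruple `(s, t, t, u')` evaluates to `1`
  have h1 : f (s⁻¹ * t * t⁻¹ * u') = 1 := (hf s hs t ht t ht u' hu').1 ⟨rfl, rfl, rfl⟩
  -- the word of the quadruple `(s', t, t', u)` is the same group element
  have hw : s'⁻¹ * t * t'⁻¹ * u = s⁻¹ * t * t⁻¹ * u' := by
    have hre : s'⁻¹ * t * t'⁻¹ * u = s⁻¹ * (s * s'⁻¹ * (t * t'⁻¹) * (u * u'⁻¹)) * u' := by group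
    rw [hre, hprod]
    group
  by_contra hne
  have h0 : f (s'⁻¹ * t * t'⁻¹ * u) = 0 :=
    (hf s' hs' t ht t' ht' u hu).2 fun h => hne ⟨h.1.symm, h.2.1, h.2.2⟩
  rw [hw, h1] at h0
  exact one_ne_zero h0

end Summit.MatrixMultiplication.MatrixMultiplication.Theorems
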